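import Summits.AtomisticToContinuum.Crystallization.Theorems.ChartedZeroExcessLayeredLatticeLiouvilleZZZYRCZX
import Summits.AtomisticToContinuum.Crystallization.Theorems.ChartedPlanarOrderDoorLayeredNear

/-!
# Coarse twins of equilibrium charts and the two obstructions — lens-2 g100 «ZZZYREB» (finding «COARSE-CHART»)

PROVED, elementary: (§1) the DOUBLED chart `(doubleChart L, doubleOffsets L w)` — generators `2·L t₁, 2·L t₂`, the four cosets of `2ℤ²` in `ℤ²`
as four layers per fine layer — presents the SAME point set (`layeredHom_doubleChart`), and is an equilibrium chart at scale `2a` as soon as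
`(L, w)` is one at scale `a` and `2‖L‖ ≤ Λ` (`isEquilChart_double`: cleanliness and the Nash property see only the set); (§2) OBSTRUCTION A: every
`c`-co-Lipschitz presentation `w'` of the twin's set over the doubled generators has `c ≤ ‖L‖/3` (`coLipschitz_le_third_of_double`: the four
cosets of one fine plane are four distinct layers of `w'`, two of four distinct integers differ by `≥ 3`, and every two cosets contain sites at
distance `≤ ‖L‖`); OBSTRUCTION B: the twin has NO registered presentation (`not_isRegisteredWord_double`: positive heights order the layers
strictly along the normal, but the coset layers are coplanar).  COROLLARIES (§3): `(U♯) s Λ κ₀ c₀` together with one equilibrium chart with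
`2‖L‖ ≤ Λ` forces `c₀ ≤ ‖L‖/3` (`le_third_of_uniformEquilStabilityAt`; at the route instance `(1/50, 2, κ₀, 1/2)` NO equilibrium chart with
`‖L‖ ≤ 1` can exist, `no_fine_chart_of_uniformEquilStabilityAt_half`), and the registered re-indexing `UniformReindexPC s Λ c₀ ℓ₀
(IsRegisteredWord δ)` of the doors of record is refuted by any such chart (`not_uniformReindexPC_registered`).  Consequence for line (D): the
target and the re-indexing must be WINDOWED to the fine stratum (file ZZZYRE) and the coarse strata re-charted (ZZZYRE `CoarseRechartP`).

§1 3 defs + 7 theorems · §2 6 theorems · §3 3 theorems.  Tags: [g100] new here.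
-/

noncomputable section

namespace Summit.AtomisticToContinuum.Crystallization.Theorems.ChartedZeroExcessLayeredLatticeLiouville

open scoped BigOperators RealInnerProductSpace
open Summit.AtomisticToContinuum.Crystallization.Theorems.ChartedPlanarOrderRigidityDoor (E3)
open Summit.AtomisticToContinuum.Crystallization.Theorems.ChartedPlanarOrderMesoCut (LayeredHom)
open Summit.AtomisticToContinuum.Crystallization.Theorems.ChartedPlanarOrderDoorLayered
  (Layered linearIndependent_map_triangularVec norm_triangularVec₂_one)
open Summit.AtomisticToContinuum.Crystallization.Theorems.OverbindingBudgetLiouvilleDictionary (norm_triangularVec₁_one)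
open Literature.MathematicalPhysics.StatisticalMechanics (triangularVec₁ triangularVec₂)

/-! ### §1 the doubled chart -/

/-- doubling as a continuous linear automorphism of `E3`. [g100] -/
def doubleEquiv : E3 ≃L[ℝ] E3 :=
  ContinuousLinearEquiv.equivOfInverse ((2 : ℝ) • ContinuousLinearMap.id ℝ E3) ((2⁻¹ : ℝ) • ContinuousLinearMap.id ℝ E3)
    (fun x => by simp [smul_smul]) (fun x => by simp [smul_smul])

/-- **«doubleChart L»** — the chart `2L` (the index-4 coarse twin's chart). [g100] -/
def doubleChart (L : E3 ≃L[ℝ] E3) : E3 ≃L[ℝ] E3 := L.trans doubleEquiv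

/-- **«doubleOffsets L w»** — the twin's offsets: layer `4p + ε₁ + 2ε₂` is fine layer `p` shifted by `L(ε₁t₁ + ε₂t₂)`, `ε ∈ {0,1}²`.
[g100] -/
def doubleOffsets (L : E3 ≃L[ℝ] E3) (w : ℤ → E3) : ℤ → E3 := fun m =>
  w (m / 4) + (L : E3 →L[ℝ] E3) ((((m % 4 % 2 : ℤ) : ℝ)) • triangularVec₁ 1 + (((m % 4 / 2 : ℤ) : ℝ)) • triangularVec₂ 1)

/-- the doubled chart as a map. [g100] -/
theorem coe_doubleChart (L : E3 ≃L[ℝ] E3) : (doubleChart L : E3 →L[ℝ] E3) = (2 : ℝ) • (L : E3 →L[ℝ] E3) := by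
  ext x
  simp [doubleChart, doubleEquiv]

/-- the doubled chart on a vector. [g100] -/
theorem doubleChart_apply (L : E3 ≃L[ℝ] E3) (x : E3) : (doubleChart L : E3 →L[ℝ] E3) x = (2 : ℝ) • (L : E3 →L[ℝ] E3) x := by
  rw [coe_doubleChart]
  rfl

/-- its inverse as a map. [g100] -/
theorem coe_doubleChart_symm (L : E3 ≃L[ℝ] E3) : ((doubleChart L).symm : E3 →L[ℝ] E3) = (2⁻¹ : ℝ) • (L.symm : E3 →L[ℝ] E3) := by
  ext x
  simp [doubleChart, doubleEquiv]

/-- its generators are the doubled generators. [g100] -/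
theorem gen_doubleChart (L : E3 ≃L[ℝ] E3) : gen₁ (doubleChart L) = (2 : ℝ) • gen₁ L ∧ gen₂ (doubleChart L) = (2 : ℝ) • gen₂ L := by
  simp only [gen₁, gen₂, doubleChart_apply, and_self]

/-- ★ **SAME POINT SET**: `ℤ²` is the union of the four cosets of `2ℤ²`. [g100] -/
theorem layeredHom_doubleChart (L : E3 ≃L[ℝ] E3) (w : ℤ → E3) :
    LayeredHom (doubleChart L : E3 →L[ℝ] E3) (doubleOffsets L w) = LayeredHom (L : E3 →L[ℝ] E3) w := by
  ext p
  simp only [LayeredHom, Set.mem_setOf_eq, doubleOffsets, doubleChart_apply]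
  constructor
  · rintro ⟨m, i, j, rfl⟩
    refine ⟨m / 4, 2 * i + m % 4 % 2, 2 * j + m % 4 / 2, ?_⟩
    push_cast
    simp only [map_add, map_smul]
    module
  · rintro ⟨m, i, j, rfl⟩
    refine ⟨4 * m + (i % 2 + 2 * (j % 2)), i / 2, j / 2, ?_⟩
    have h4 : (4 * m + (i % 2 + 2 * (j % 2))) / 4 = m := by omega
    have h1 : (4 * m + (i % 2 + 2 * (j % 2))) % 4 % 2 = i % 2 := by omega
    have h2 : (4 * m + (i % 2 + 2 * (j % 2))) % 4 / 2 = j % 2 := by omega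
    have hi : ((i : ℤ) : ℝ) = 2 * ((i / 2 : ℤ) : ℝ) + ((i % 2 : ℤ) : ℝ) := by
      have h : i = 2 * (i / 2) + i % 2 := by omega
      conv_lhs => rw [h]
      push_cast
      ring
    have hj : ((j : ℤ) : ℝ) = 2 * ((j / 2 : ℤ) : ℝ) + ((j % 2 : ℤ) : ℝ) := by
      have h : j = 2 * (j / 2) + j % 2 := by omega
      conv_lhs => rw [h]
      push_cast
      ring
    rw [h4, h1, h2, hi, hj]
    simp only [map_add, map_smul]
    module

/-- conformality doubles with the scale. [g100] -/
theorem isConfChart_double {a s : ℝ} {L : E3 ≃L[ℝ] E3} (h : IsConfChart a s (L : E3 →L[ℝ] E3)) :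
    IsConfChart (2 * a) s (doubleChart L : E3 →L[ℝ] E3) := by
  obtain ⟨Q, hQ⟩ := h
  refine ⟨Q, ?_⟩
  have h2 : (doubleChart L : E3 →L[ℝ] E3) - (2 * a) • (Q.toContinuousLinearEquiv : E3 →L[ℝ] E3) =
      (2 : ℝ) • ((L : E3 →L[ℝ] E3) - a • (Q.toContinuousLinearEquiv : E3 →L[ℝ] E3)) := by
    rw [coe_doubleChart, smul_sub, smul_smul]
  rw [h2, norm_smul, Real.norm_eq_abs, abs_two]
  linarith

/-- ★ **THE TWIN IS AN EQUILIBRIUM CHART** at scale `2a`, as soon as `2‖L‖ ≤ Λ`. [g100] -/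
theorem isEquilChart_double {a s Λ : ℝ} {L : E3 ≃L[ℝ] E3} {w : ℤ → E3} (hE : IsEquilChart a s Λ L w)
    (hΛ : 2 * ‖(L : E3 →L[ℝ] E3)‖ ≤ Λ) : IsEquilChart (2 * a) s Λ (doubleChart L) (doubleOffsets L w) := by
  obtain ⟨-, h2, h3, h4, h5⟩ := hE
  refine ⟨?_, ?_, isConfChart_double h3, ?_, ?_⟩
  · rw [coe_doubleChart, norm_smul, Real.norm_eq_abs, abs_two]
    exact hΛ
  · rw [coe_doubleChart_symm, norm_smul, Real.norm_eq_abs, abs_inv, abs_two]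
    have h0 : 0 ≤ ‖(L.symm : E3 →L[ℝ] E3)‖ := norm_nonneg _
    linarith
  · rw [layeredHom_doubleChart]
    exact h4
  · rw [layeredHom_doubleChart]
    exact h5

/-! ### §2 the two obstructions -/

/-- every fine-lattice point of fine layer `0` is a site of any presentation `w'` of the twin's set. [g100] -/
theorem exists_coarse_index {L : E3 ≃L[ℝ] E3} {w w' : ℤ → E3}
    (hset : Layered (gen₁ (doubleChart L)) (gen₂ (doubleChart L)) w' = LayeredHom (doubleChart L : E3 →L[ℝ] E3) (doubleOffsets L w))
    (i j : ℤ) : ∃ m I J : ℤ, (L : E3 →L[ℝ] E3) (((i : ℝ)) • triangularVec₁ 1 + ((j : ℝ)) • triangularVec₂ 1) + w 0 =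
      (((I : ℝ)) • gen₁ (doubleChart L) + ((J : ℝ)) • gen₂ (doubleChart L)) + w' m := by
  have hmem : (L : E3 →L[ℝ] E3) (((i : ℝ)) • triangularVec₁ 1 + ((j : ℝ)) • triangularVec₂ 1) + w 0 ∈ LayeredHom (L : E3 →L[ℝ] E3) w :=
    ⟨0, i, j, rfl⟩
  rw [← layeredHom_doubleChart L w, ← hset] at hmem
  obtain ⟨m, I, J, h⟩ := hmem
  exact ⟨m, I, J, h⟩

/-- two fine points in the SAME layer of `w'` differ by an element of `2ℤ²` (the doubled generators are independent). [g100] -/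
theorem even_of_same_layer {L : E3 ≃L[ℝ] E3} {w w' : ℤ → E3} {i j i' j' m I J I' J' : ℤ}
    (h : (L : E3 →L[ℝ] E3) (((i : ℝ)) • triangularVec₁ 1 + ((j : ℝ)) • triangularVec₂ 1) + w 0 =
      (((I : ℝ)) • gen₁ (doubleChart L) + ((J : ℝ)) • gen₂ (doubleChart L)) + w' m)
    (h' : (L : E3 →L[ℝ] E3) (((i' : ℝ)) • triangularVec₁ 1 + ((j' : ℝ)) • triangularVec₂ 1) + w 0 =
      (((I' : ℝ)) • gen₁ (doubleChart L) + ((J' : ℝ)) • gen₂ (doubleChart L)) + w' m) :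
    i - i' = 2 * (I - I') ∧ j - j' = 2 * (J - J') := by
  rw [(gen_doubleChart L).1, (gen_doubleChart L).2] at h h'
  simp only [gen₁, gen₂, map_add, map_smul] at h h'
  have key : ((i : ℝ) - i' - 2 * (I - I')) • (L : E3 →L[ℝ] E3) (triangularVec₁ 1) +
      ((j : ℝ) - j' - 2 * (J - J')) • (L : E3 →L[ℝ] E3) (triangularVec₂ 1) = 0 := by
    have d : ((i : ℝ) • (L : E3 →L[ℝ] E3) (triangularVec₁ 1) + (j : ℝ) • (L : E3 →L[ℝ] E3) (triangularVec₂ 1) + w 0) -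
        ((i' : ℝ) • (L : E3 →L[ℝ] E3) (triangularVec₁ 1) + (j' : ℝ) • (L : E3 →L[ℝ] E3) (triangularVec₂ 1) + w 0) -
        (((I : ℝ) • ((2 : ℝ) • (L : E3 →L[ℝ] E3) (triangularVec₁ 1)) + (J : ℝ) • ((2 : ℝ) • (L : E3 →L[ℝ] E3) (triangularVec₂ 1)) +
            w' m) -
          ((I' : ℝ) • ((2 : ℝ) • (L : E3 →L[ℝ] E3) (triangularVec₁ 1)) +
            (J' : ℝ) • ((2 : ℝ) • (L : E3 →L[ℝ] E3) (triangularVec₂ 1)) + w' m)) = 0 := by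
      rw [h, h', sub_self]
    rw [← d]
    module
  obtain ⟨h1, h2⟩ := LinearIndependent.pair_iff.1 (linearIndependent_map_triangularVec L) _ _ key
  constructor
  · have h1' : ((i - i' : ℤ) : ℝ) = ((2 * (I - I') : ℤ) : ℝ) := by push_cast; linarith
    exact_mod_cast h1'
  · have h2' : ((j - j' : ℤ) : ℝ) = ((2 * (J - J') : ℤ) : ℝ) := by push_cast; linarith
    exact_mod_cast h2'

/-- the third hexagonal direction `t₁ − t₂` is a unit vector. [g100] -/
theorem norm_triangularVec₁_sub_triangularVec₂ : ‖triangularVec₁ 1 - triangularVec₂ 1‖ = 1 := by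
  have h3 : Real.sqrt 3 ^ 2 = 3 := Real.sq_sqrt (by norm_num)
  rw [EuclideanSpace.norm_eq, Fin.sum_univ_three, Real.sqrt_eq_one]
  simp [triangularVec₁, triangularVec₂, div_pow, h3]
  norm_num

/-- the co-Lipschitz constant read on two fine points: `c·|m − m'| ≤ ‖L‖·‖(i−i')t₁ + (j−j')t₂‖` for their layers `m, m'` in `w'`.
[g100] -/
theorem coLip_pair {c : ℝ} {L : E3 ≃L[ℝ] E3} {w w' : ℤ → E3} (hco : IsLayeredCrystal c (gen₁ (doubleChart L)) (gen₂ (doubleChart L)) w')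
    (hc : 0 ≤ c) {i j i' j' m I J m' I' J' : ℤ}
    (h : (L : E3 →L[ℝ] E3) (((i : ℝ)) • triangularVec₁ 1 + ((j : ℝ)) • triangularVec₂ 1) + w 0 =
      (((I : ℝ)) • gen₁ (doubleChart L) + ((J : ℝ)) • gen₂ (doubleChart L)) + w' m)
    (h' : (L : E3 →L[ℝ] E3) (((i' : ℝ)) • triangularVec₁ 1 + ((j' : ℝ)) • triangularVec₂ 1) + w 0 =
      (((I' : ℝ)) • gen₁ (doubleChart L) + ((J' : ℝ)) • gen₂ (doubleChart L)) + w' m') :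
    c * |((m : ℝ)) - m'| ≤
      ‖(L : E3 →L[ℝ] E3)‖ * ‖(((i - i' : ℤ)) : ℝ) • triangularVec₁ 1 + (((j - j' : ℤ)) : ℝ) • triangularVec₂ 1‖ := by
  have hxy := hco (![I, J], m) (![I', J'], m')
  have hd : |((m : ℝ)) - m'| ≤ dist ((![I, J], m) : Cell 2 × ℤ) (![I', J'], m') := by
    rw [Prod.dist_eq, Int.dist_eq]
    exact le_max_right _ _
  have hs : lsite (gen₁ (doubleChart L)) (gen₂ (doubleChart L)) w' ![I, J] m - lsite (gen₁ (doubleChart L)) (gen₂ (doubleChart L)) w' ![I', J'] m' =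
      (L : E3 →L[ℝ] E3) ((((i - i' : ℤ)) : ℝ) • triangularVec₁ 1 + (((j - j' : ℤ)) : ℝ) • triangularVec₂ 1) := by
    have e1 : lsite (gen₁ (doubleChart L)) (gen₂ (doubleChart L)) w' ![I, J] m =
        (L : E3 →L[ℝ] E3) (((i : ℝ)) • triangularVec₁ 1 + ((j : ℝ)) • triangularVec₂ 1) + w 0 := by
      rw [h]; simp [lsite]
    have e2 : lsite (gen₁ (doubleChart L)) (gen₂ (doubleChart L)) w' ![I', J'] m' =
        (L : E3 →L[ℝ] E3) (((i' : ℝ)) • triangularVec₁ 1 + ((j' : ℝ)) • triangularVec₂ 1) + w 0 := by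
      rw [h']; simp [lsite]
    rw [e1, e2]
    push_cast
    simp only [map_add, map_smul, map_sub, sub_smul]
    abel
  calc c * |((m : ℝ)) - m'| ≤ c * dist ((![I, J], m) : Cell 2 × ℤ) (![I', J'], m') := mul_le_mul_of_nonneg_left hd hc
    _ ≤ ‖lsite (gen₁ (doubleChart L)) (gen₂ (doubleChart L)) w' ![I, J] m -
          lsite (gen₁ (doubleChart L)) (gen₂ (doubleChart L)) w' ![I', J'] m'‖ := hxy
    _ = ‖(L : E3 →L[ℝ] E3) ((((i - i' : ℤ)) : ℝ) • triangularVec₁ 1 + (((j - j' : ℤ)) : ℝ) • triangularVec₂ 1)‖ := by rw [hs]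
    _ ≤ ‖(L : E3 →L[ℝ] E3)‖ * ‖(((i - i' : ℤ)) : ℝ) • triangularVec₁ 1 + (((j - j' : ℤ)) : ℝ) • triangularVec₂ 1‖ :=
      (L : E3 →L[ℝ] E3).le_opNorm _

/-- ★★ **OBSTRUCTION A (PROVED)**: every co-Lipschitz presentation of the twin's set over the doubled generators has constant `≤ ‖L‖/3`. [g100] -/
theorem coLipschitz_le_third_of_double {c : ℝ} {L : E3 ≃L[ℝ] E3} {w w' : ℤ → E3}
    (hset : Layered (gen₁ (doubleChart L)) (gen₂ (doubleChart L)) w' = LayeredHom (doubleChart L : E3 →L[ℝ] E3) (doubleOffsets L w))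
    (hco : IsLayeredCrystal c (gen₁ (doubleChart L)) (gen₂ (doubleChart L)) w') : c ≤ ‖(L : E3 →L[ℝ] E3)‖ / 3 := by
  rcases lt_or_ge c 0 with hc | hc
  · have h0 : 0 ≤ ‖(L : E3 →L[ℝ] E3)‖ := norm_nonneg _
    linarith
  obtain ⟨mA, IA, JA, hA⟩ := exists_coarse_index hset 0 0
  obtain ⟨mB, IB, JB, hB⟩ := exists_coarse_index hset 1 0
  obtain ⟨mC, IC, JC, hC⟩ := exists_coarse_index hset 0 1
  obtain ⟨mD, ID, JD, hD⟩ := exists_coarse_index hset 1 (-1)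
  -- the fifth point `L(t₁ + t₂) + w 0` lies in the layer of `D`
  have hE : (L : E3 →L[ℝ] E3) ((((1 : ℤ) : ℝ)) • triangularVec₁ 1 + (((1 : ℤ) : ℝ)) • triangularVec₂ 1) + w 0 =
      ((((ID : ℤ) : ℝ)) • gen₁ (doubleChart L) + (((JD + 1 : ℤ) : ℝ)) • gen₂ (doubleChart L)) + w' mD := by
    have e : (L : E3 →L[ℝ] E3) ((((1 : ℤ) : ℝ)) • triangularVec₁ 1 + (((1 : ℤ) : ℝ)) • triangularVec₂ 1) + w 0 =
        ((L : E3 →L[ℝ] E3) ((((1 : ℤ) : ℝ)) • triangularVec₁ 1 + (((-1 : ℤ) : ℝ)) • triangularVec₂ 1) + w 0) + gen₂ (doubleChart L) := by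
      rw [(gen_doubleChart L).2]
      simp only [gen₂, map_add, map_smul]
      push_cast
      module
    rw [e, hD]
    push_cast
    module
  -- the four layers are pairwise distinct
  have hAB : mA ≠ mB := fun h => by obtain ⟨h1, -⟩ := even_of_same_layer hA (h ▸ hB); omega
  have hAC : mA ≠ mC := fun h => by obtain ⟨-, h2⟩ := even_of_same_layer hA (h ▸ hC); omega
  have hAD : mA ≠ mD := fun h => by obtain ⟨h1, -⟩ := even_of_same_layer hA (h ▸ hD); omega
  have hBC : mB ≠ mC := fun h => by obtain ⟨h1, -⟩ := even_of_same_layer hB (h ▸ hC); omega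
  have hBD : mB ≠ mD := fun h => by obtain ⟨-, h2⟩ := even_of_same_layer hB (h ▸ hD); omega
  have hCD : mC ≠ mD := fun h => by obtain ⟨h1, -⟩ := even_of_same_layer hC (h ▸ hD); omega
  -- unit difference vectors
  have n1 := norm_triangularVec₁_one
  have n2 := norm_triangularVec₂_one
  have n3 := norm_triangularVec₁_sub_triangularVec₂
  have fin : ∀ {m m' : ℤ} {v : E3}, c * |((m : ℝ)) - m'| ≤ ‖(L : E3 →L[ℝ] E3)‖ * ‖v‖ → ‖v‖ = 1 → 3 ≤ m - m' ∨ 3 ≤ m' - m →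
      c ≤ ‖(L : E3 →L[ℝ] E3)‖ / 3 := by
    intro m m' v h hv hgap
    rw [hv, mul_one] at h
    have h3 : (3 : ℝ) ≤ |((m : ℝ)) - m'| := by
      rcases hgap with hg | hg
      · have hg' : ((3 : ℤ) : ℝ) ≤ ((m - m' : ℤ) : ℝ) := by exact_mod_cast hg
        push_cast at hg'
        exact hg'.trans (le_abs_self _)
      · have hg' : ((3 : ℤ) : ℝ) ≤ ((m' - m : ℤ) : ℝ) := by exact_mod_cast hg
        push_cast at hg'
        rw [abs_sub_comm]
        exact hg'.trans (le_abs_self _)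
    have := mul_le_mul_of_nonneg_left h3 hc
    linarith
  have pAB := coLip_pair hco hc hA hB
  have pAC := coLip_pair hco hc hA hC
  have pAD := coLip_pair hco hc hA hD
  have pBC := coLip_pair hco hc hB hC
  have pBD := coLip_pair hco hc hB hD
  have pCE := coLip_pair hco hc hC hE
  push_cast at pAB pAC pAD pBC pBD pCE
  simp only [neg_smul, one_smul, zero_smul, add_zero, zero_add, norm_neg] at pAB pAC pAD pBC pBD pCE
  rcases (by omega : (3 ≤ mA - mB ∨ 3 ≤ mB - mA) ∨ (3 ≤ mA - mC ∨ 3 ≤ mC - mA) ∨ (3 ≤ mA - mD ∨ 3 ≤ mD - mA) ∨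
      (3 ≤ mB - mC ∨ 3 ≤ mC - mB) ∨ (3 ≤ mB - mD ∨ 3 ≤ mD - mB) ∨ (3 ≤ mC - mD ∨ 3 ≤ mD - mC)) with h | h | h | h | h | h
  · exact fin pAB n1 h
  · exact fin pAC n2 h
  · exact fin pAD (by rw [neg_add_eq_sub, ← norm_neg, neg_sub]; exact n3) h
  · exact fin pBC (by rw [← sub_eq_add_neg] ; exact n3) h
  · exact fin pBD n2 h
  · exact fin pCE n1 h

/-- ★★ **OBSTRUCTION B (PROVED)**: the twin has NO registered presentation (positive heights vs coplanar coset layers). [g100] -/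
theorem not_isRegisteredWord_double {δ a : ℝ} {L : E3 ≃L[ℝ] E3} {w w' : ℤ → E3}
    (hset : Layered (gen₁ (doubleChart L)) (gen₂ (doubleChart L)) w' = LayeredHom (doubleChart L : E3 →L[ℝ] E3) (doubleOffsets L w)) :
    ¬ IsRegisteredWord δ a (doubleChart L) w' := by
  rintro ⟨ℓ, n, r, h, -, hn, hg₁, hg₂, hr, hstep⟩
  have hmono : StrictMono fun m : ℤ => ⟪w' m, n⟫ := strictMono_int_of_lt_succ fun m => by
    have hm : ⟪w' (m + 1) - w' m, n⟫ = h m := by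
      rw [hstep m]
      exact inner_registeredStep hn hg₁ hg₂ (hr m).2.1 _ _
    rw [inner_sub_left] at hm
    have := (hr m).2.2
    show ⟪w' m, n⟫ < ⟪w' (m + 1), n⟫
    linarith
  obtain ⟨mA, IA, JA, hA⟩ := exists_coarse_index hset 0 0
  obtain ⟨mB, IB, JB, hB⟩ := exists_coarse_index hset 1 0
  have hAB : mA ≠ mB := fun h => by obtain ⟨h1, -⟩ := even_of_same_layer hA (h ▸ hB); omega
  have hL1 : ⟪(L : E3 →L[ℝ] E3) (triangularVec₁ 1), n⟫ = 0 := by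
    have h := hg₁
    rw [(gen_doubleChart L).1, real_inner_smul_left] at h
    have h' : ⟪gen₁ L, n⟫ = 0 := by linarith
    exact h'
  have hL2 : ⟪(L : E3 →L[ℝ] E3) (triangularVec₂ 1), n⟫ = 0 := by
    have h := hg₂
    rw [(gen_doubleChart L).2, real_inner_smul_left] at h
    have h' : ⟪gen₂ L, n⟫ = 0 := by linarith
    exact h'
  have key : ∀ {i j m I J : ℤ}, (L : E3 →L[ℝ] E3) (((i : ℝ)) • triangularVec₁ 1 + ((j : ℝ)) • triangularVec₂ 1) + w 0 =
      (((I : ℝ)) • gen₁ (doubleChart L) + ((J : ℝ)) • gen₂ (doubleChart L)) + w' m → ⟪w' m, n⟫ = ⟪w 0, n⟫ := by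
    intro i j m I J h
    have h' : w' m = ((L : E3 →L[ℝ] E3) (((i : ℝ)) • triangularVec₁ 1 + ((j : ℝ)) • triangularVec₂ 1) + w 0) -
        (((I : ℝ)) • gen₁ (doubleChart L) + ((J : ℝ)) • gen₂ (doubleChart L)) := by
      rw [h]; abel
    rw [h']
    simp only [inner_sub_left, inner_add_left, map_add, map_smul, real_inner_smul_left, hL1, hL2, hg₁, hg₂, mul_zero, add_zero,
      zero_add, sub_zero]
  exact hAB (hmono.injective ((key hA).trans (key hB).symm))

/-! ### §3 corollaries for (U♯) and for the registered re-indexing of the doors of record -/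

/-- ★★ (U♯) together with ONE equilibrium chart with `2‖L‖ ≤ Λ` forces `c₀ ≤ ‖L‖/3`. [g100] -/
theorem le_third_of_uniformEquilStabilityAt {s Λ κ₀ c₀ a : ℝ} {L : E3 ≃L[ℝ] E3} {w : ℤ → E3} (hU : UniformEquilStabilityAt s Λ κ₀ c₀)
    (hE : IsEquilChart a s Λ L w) (ha : 0 < a) (hΛ : 2 * ‖(L : E3 →L[ℝ] E3)‖ ≤ Λ) : c₀ ≤ ‖(L : E3 →L[ℝ] E3)‖ / 3 := by
  obtain ⟨w', hset, hco, -⟩ := hU (2 * a) (by positivity) (doubleChart L) (doubleOffsets L w) (isEquilChart_double hE hΛ)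
  exact coLipschitz_le_third_of_double hset hco

/-- ★★ AT THE ROUTE INSTANCE: `(U♯)(1/50, 2, κ₀, 1/2)` admits NO equilibrium chart with `‖L‖ ≤ 1` — the fine fcc stratum would be empty.
[g100] -/
theorem no_fine_chart_of_uniformEquilStabilityAt_half {κ₀ a : ℝ} {L : E3 ≃L[ℝ] E3} {w : ℤ → E3}
    (hU : UniformEquilStabilityAt (1 / 50) 2 κ₀ (1 / 2)) (hE : IsEquilChart a (1 / 50) 2 L w) (ha : 0 < a)
    (hL : ‖(L : E3 →L[ℝ] E3)‖ ≤ 1) : False := by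
  have h := le_third_of_uniformEquilStabilityAt hU hE ha (by linarith)
  linarith

/-- ★★ the REGISTERED re-indexing of the doors of record (`hRI` of ZZZYRCZN/ZZZYRCZX) is refuted by any equilibrium chart with `2‖L‖ ≤ Λ`. [g100] -/
theorem not_uniformReindexPC_registered {s Λ c₀ ℓ₀ δ a : ℝ} {L : E3 ≃L[ℝ] E3} {w : ℤ → E3}
    (hRI : UniformReindexPC s Λ c₀ ℓ₀ (IsRegisteredWord δ)) (hE : IsEquilChart a s Λ L w) (ha : 0 < a)
    (hΛ : 2 * ‖(L : E3 →L[ℝ] E3)‖ ≤ Λ) : False := by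
  obtain ⟨w', hset, -, -, hreg⟩ := hRI (2 * a) (by positivity) (doubleChart L) (doubleOffsets L w) (isEquilChart_double hE hΛ)
  exact not_isRegisteredWord_double hset hreg

end Summit.AtomisticToContinuum.Crystallization.Theorems.ChartedZeroExcessLayeredLatticeLiouville

end
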